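import Summits.ResolutionOfSingularities.ResolutionOfSingularities.Theorems.HilbertSamuelEliminationSigmaMaxModificationsCorridor3WLadderSegmentsBirthZero
import Summits.ResolutionOfSingularities.ResolutionOfSingularities.Theorems.HilbertSamuelEliminationSigmaMaxModificationsCorridor3WLadderRecognitionNearLocusWUnit
import HarnessLib

/-!
# [OURS · L1 W4.2] THE FIRST BIRTH OF THE UNIT, KEYED ON A POINT HYPOTHESIS `F` (the `p = 2` / `Q`-generic twin of `…SegmentsBirthZero`):
# `N_1 ⊆ ℙ(Dir_{x_b})` by the point-locus form of CJS Thm. 3.14 keyed on `F` (stub-2's `BlowupTowerNearW.nearLocus_one_subset_projDir`), and the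
# projective-line facts of `ℙ(Dir)` for `e_{x_b} = 2`, read on `Seg.unitTowerL b 0` and transferred back to the chain
# (crux `SigmaMaxModifications` stmt-ResolutionOfSingularities-18506; conjunct `SigmaMaxModificationsCorridor3` stmt-…-19249; line `w_ladder`;
# RECOGNITION assembly, Step A, division (c′) of res-L1-w42-plan-1 RULING v3.14-24 (GD))

Pool seat res-D-pv-038 (gen 8). Helper file `--supports stmt-ResolutionOfSingularities-19249 --as helper`; kernel only, no new definition.

This is `Seg.dichPlus_regN_birth_zero` (res-L1-w42-stub-1, `…SegmentsBirthZero`) VERBATIM with the (F1) characteristic hypothesis `CharHypothesis` at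
`x_b` replaced by an ARBITRARY point hypothesis `F` holding along the near loci of the localised tower `locTower b` (hypothesis `hF`; only its value
at the base point is used here), and the printed binder `Thm314_point_locus` replaced by the same statement keyed on `F` (section variable `h314pt`,
the shape of stub-2's `BlowupTowerNearW`, res-L1-w42-stub-2). Instances: `F := CharHypothesis` is the char row; `F := GeomDirHypothesis` with the
binder `Thm314_point_locus_geomDir` is the `p = 2` / `Q`-generic row (`Seg.UnitGeometryAtQM 2 ⊤` for res-L1-w42-stub-3 / res-L1-w42-stub-4's census).

* **`Seg.dichPlus_regN_birth_zeroF`** — (Dich⁺) ∧ (RegN) at the chain stage `relIdxL b 0 1` (`= 1`), keyed on `F`.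
* **`Seg.unitTowerU_C_one_eq_projDirF`** — clause (ii)′ of Def. 6.38 on `unitTowerU` (`C_1 = ℙ(Dir)`), keyed on `F` (twin of res-L1-w42-stub-1's
  `Seg.unitTowerU_C_one_eq_projDir`, `…SegmentsCentreOne`).

OURS bookkeeping; NOT a statement of the manuscript [Hironaka2017] nor of [CossartJannsenSaito2020]. AI-written; AI review is weaker than expert
review.

References: V. Cossart, U. Jannsen, S. Saito, LNM 2270 (2020), Thm. 3.14, Def. 6.34, Def. 6.38, p. 103–107 [CossartJannsenSaito2020].
-/

noncomputable section

set_option linter.dupNamespace false -- namespace `…Corridor3.Moving` re-enters `…Corridor3` (module convention of the Moving files)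

open CategoryTheory AlgebraicGeometry TopologicalSpace Topology IsLocalRing
open Literature.AlgebraicGeometry.Resolution Literature.RingTheory.HilbertSamuel
open Literature.AlgebraicGeometry.CossartJannsenSaito2020
open Summit.ResolutionOfSingularities.ResolutionOfSingularities.Theorems.CampaignW42
open Summit.ResolutionOfSingularities.ResolutionOfSingularities.Theorems.SigmaMaxModificationsCorridor3.Helpers

namespace Summit.ResolutionOfSingularities.ResolutionOfSingularities.Theorems.SigmaMaxModificationsCorridor3.Moving.Seg

section BirthZeroF

variable {R : ∀ S : Scheme.{0}, CentreSeq S → Prop} {N : ℕ} {ν : ℕ → ℕ} {k : Type} [Field k]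
  {c : ℕ → MarkedStage.{0}} (hc : ∀ n, CanonicalNearStep R N ν (c n) (c (n + 1))) (hRf : OracleFunctional R) (hRa : OracleAdmissible R)
  (hν : ν ≠ iterPSum N Phi) (h0 : Helpers.CycleInv k N ν (c 0)) (hgen : ∀ n, ∃ m, n ≤ m ∧ (c m).IsBlownUp R N ν)
  {p : ℕ} {X : Scheme.{0}} [IsLocallyNoetherian X] {x : X} (hX : IsMaximalOrigin p N ν X x)
  (hreach : Reaches R N ν (MarkedStage.init X x) (c 0))
  (F : ∀ (X : Scheme.{0}) [IsLocallyNoetherian X], X → Prop)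
  (h314pt : ∀ (X X' : Scheme.{0}) [IsLocallyNoetherian X] (π : X' ⟶ X) (x : X) (hx : IsClosed ({x} : Set X)) (N : ℕ)
    (x' : X'), Scheme.IsExcellent X → IdealSheafData.IsPermissible (Scheme.IdealSheafData.vanishingIdeal ⟨{x}, hx⟩) →
      IsBlowup π (Scheme.IdealSheafData.vanishingIdeal ⟨{x}, hx⟩) → topologicalKrullDim ↥X ≤ (N : WithBot ℕ∞) → π.base x' = x → F X x →
        Scheme.hsFun X' N x' = Scheme.hsFun X N x → IsOnProjDirectrix π x')

include hRf hX hreach h314pt in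
/-- **THE FIRST BIRTH, keyed on a point hypothesis `F`.** At a blown-up isolated base `b` with `e_{x_b} = 2` and `F` along the near loci of `locTower b`:
(Dich⁺) and (RegN) at the chain stage right after the base (index `relIdxL b 0 1`), modulo the point-locus form of Thm. 3.14 keyed on `F` (section
variable `h314pt`). `F := CharHypothesis` recovers `Seg.dichPlus_regN_birth_zero`. [cite: CossartJannsenSaito2020, Thm. 3.14, Def. 6.34 (i), p. 103–105] -/
theorem dichPlus_regN_birth_zeroF (b : ℕ) (hb : (c b).IsBlownUp R N ν) (hiso : Iso N (c b))
    (hF : ∀ n, ∀ y ∈ (locTower hc hRa hν h0 b).nearLocus N (basePt hc hRa hν h0 b) n,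
      @F ((locTower hc hRa hν h0 b).X n) ((locTower hc hRa hν h0 b).ln n) y)
    (he : dirDim (c b) = 2) :
    ((((upTower hc hRa hν h0 b).nearLocus N (c b).pt (Seg.relIdxL hgen b 0 1)).Infinite ∧
        IsIrreducible ((upTower hc hRa hν h0 b).nearLocus N (c b).pt (Seg.relIdxL hgen b 0 1)) ∧
        ∀ y ∈ (upTower hc hRa hν h0 b).nearLocus N (c b).pt (Seg.relIdxL hgen b 0 1),
          ¬ IsGenericPoint y ((upTower hc hRa hν h0 b).nearLocus N (c b).pt (Seg.relIdxL hgen b 0 1)) →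
            IsClosed ({y} : Set (c (b + Seg.relIdxL hgen b 0 1)).W)) ∨
      (((upTower hc hRa hν h0 b).nearLocus N (c b).pt (Seg.relIdxL hgen b 0 1)).Finite ∧
        ∀ y ∈ (upTower hc hRa hν h0 b).nearLocus N (c b).pt (Seg.relIdxL hgen b 0 1),
          IsClosed ({y} : Set (c (b + Seg.relIdxL hgen b 0 1)).W))) ∧
    (((upTower hc hRa hν h0 b).nearLocus N (c b).pt (Seg.relIdxL hgen b 0 1)).Infinite →
      ∀ h : IsClosed ((upTower hc hRa hν h0 b).nearLocus N (c b).pt (Seg.relIdxL hgen b 0 1)),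
        Scheme.IsRegular (Scheme.IdealSheafData.vanishingIdeal ⟨(upTower hc hRa hν h0 b).nearLocus N (c b).pt (Seg.relIdxL hgen b 0 1), h⟩).subscheme) := by
  haveI : IsLocallyNoetherian ((upTower hc hRa hν h0 b).X 0) := (upTower hc hRa hν h0 b).ln 0
  haveI : IsLocallyNoetherian (c b).W := (c b).ln
  haveI := flat_fromSpecStalk ((upTower hc hRa hν h0 b).X 0) ((c b).pt : (upTower hc hRa hν h0 b).X 0)
  obtain ⟨k', _, _, hg⟩ := hX.exists_stateGood_of_reaches hRa hν (reaches_chain hreach hc b)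
  have hU := stratumIsolated_of_iso hg hiso
  have hempL : ∀ n, n < Seg.relIdx hgen b 0 → ¬ (c (b + n)).IsBlownUp R N ν → (locTower hc hRa hν h0 b).C n = ∅ :=
    fun n hn => absurd hn (Nat.not_lt_zero n)
  -- data of the localised tower `T = unitTowerL b 0`
  have hkey := keySetting_unitTowerL hc hRa hν h0 hgen hempL (N := N)
  have hperm := isPermissible_centreIdeal_unitTowerL hc hRa hν h0 hgen hempL (N := N)
  have hx : IsClosed ({basePt hc hRa hν h0 b} : Set ((unitTowerL hc hRa hν h0 hgen b 0 hempL).X 0)) := isClosed_singleton_closedPoint _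
  have hC0 := unitTowerL_C_zero hc hRf hRa hν h0 hgen hX hreach b 0 hempL hb hU
  have heT : (unitTowerL hc hRa hν h0 hgen b 0 hempL).dirDimAt 0 (basePt hc hRa hν h0 b) = 2 :=
    (Scheme.dirDim_fromSpecStalk_closedPoint (c b).W (c b).pt).trans he
  -- the point hypothesis `F` along the near loci of `unitTowerL b 0` (its stages ARE stages of `locTower b`)
  have hFT : ∀ i, ∀ y ∈ (unitTowerL hc hRa hν h0 hgen b 0 hempL).nearLocus N (basePt hc hRa hν h0 b) i,
      @F ((unitTowerL hc hRa hν h0 hgen b 0 hempL).X i) ((unitTowerL hc hRa hν h0 hgen b 0 hempL).ln i) y := fun i y hy =>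
    hF (Seg.relIdxL hgen b 0 i) y
      (((locTower hc hRa hν h0 b).nearLocus_compress_zero (htriv_of_hEmpL hc hRa hν h0 hgen hempL) N (basePt hc hRa hν h0 b) i) ▸ hy)
  have hsub := BlowupTowerNearW.nearLocus_one_subset_projDir (T := unitTowerL hc hRa hν h0 hgen b 0 hempL) F h314pt hkey hperm hx hC0 hFT
  obtain ⟨hKcl, hKirr, hKnt, hKpts⟩ := BlowupTowerNear.curveData_projDir (T := unitTowerL hc hRa hν h0 hgen b 0 hempL) ProjDir_projLine_holds hx hC0 heT
  -- the projective line facts of P-a: generic point not closed, regular reduced structure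
  have hbl : IsBlowup ((unitTowerL hc hRa hν h0 hgen b 0 hempL).π 0)
      (Scheme.IdealSheafData.vanishingIdeal ⟨{basePt hc hRa hν h0 b}, hx⟩) := by
    have h := (unitTowerL hc hRa hν h0 hgen b 0 hempL).isBlowup 0
    have hcl : (⟨(unitTowerL hc hRa hν h0 hgen b 0 hempL).C 0, (unitTowerL hc hRa hν h0 hgen b 0 hempL).isClosed_C 0⟩ :
        Closeds ((unitTowerL hc hRa hν h0 hgen b 0 hempL).X 0)) = ⟨{basePt hc hRa hν h0 b}, hx⟩ := Closeds.ext hC0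
    rwa [hcl] at h
  haveI : IsLocallyNoetherian ((unitTowerL hc hRa hν h0 hgen b 0 hempL).X 0) := (unitTowerL hc hRa hν h0 hgen b 0 hempL).ln 0
  obtain ⟨-, -, hKgen, -, hKreg⟩ := ProjDir_projLine_holds ((unitTowerL hc hRa hν h0 hgen b 0 hempL).X 0) ((unitTowerL hc hRa hν h0 hgen b 0 hempL).X 1)
    ((unitTowerL hc hRa hν h0 hgen b 0 hempL).π 0) (basePt hc hRa hν h0 b) hx hbl heT
  -- abbreviations
  have hNeq' := nearLocus_unitTowerL hc hRa hν h0 hgen hempL (b := b) (L := 0) 1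
  have hNcl : IsClosed ((upTower hc hRa hν h0 b).nearLocus N (c b).pt (Seg.relIdxL hgen b 0 1)) := isClosed_nearLocus hc hRa hν h0 hX hreach b _
  have hNTcl : IsClosed ((unitTowerL hc hRa hν h0 hgen b 0 hempL).nearLocus N (basePt hc hRa hν h0 b) 1) := by
    rw [hNeq']; exact hNcl.preimage (locι hc hRa hν h0 b _).continuous
  have hrange : (upTower hc hRa hν h0 b).nearLocus N (c b).pt (Seg.relIdxL hgen b 0 1) ⊆ Set.range (locι hc hRa hν h0 b (Seg.relIdxL hgen b 0 1)).base := by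
    have h := BlowupTowerNear.nearLocus_subset_range_bcι (upTower hc hRa hν h0 b)
      (((upTower hc hRa hν h0 b).X 0).fromSpecStalk ((c b).pt : (upTower hc hRa hν h0 b).X 0)) N (basePt hc hRa hν h0 b) (Seg.relIdxL hgen b 0 1)
    rw [show (((upTower hc hRa hν h0 b).X 0).fromSpecStalk ((c b).pt : (upTower hc hRa hν h0 b).X 0)).base (basePt hc hRa hν h0 b) = (c b).pt
      from Scheme.fromSpecStalk_closedPoint] at h
    exact h
  have hemb : Topology.IsEmbedding (locι hc hRa hν h0 b (Seg.relIdxL hgen b 0 1)).base :=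
    @Scheme.Hom.isEmbedding _ _ (locι hc hRa hν h0 b (Seg.relIdxL hgen b 0 1))
      ((upTower hc hRa hν h0 b).isPreimmersion_bcι (((upTower hc hRa hν h0 b).X 0).fromSpecStalk ((c b).pt : (upTower hc hRa hν h0 b).X 0)) _)
  have hsurj : (locι hc hRa hν h0 b (Seg.relIdxL hgen b 0 1)).base '' ((locι hc hRa hν h0 b (Seg.relIdxL hgen b 0 1)).base ⁻¹'
      (upTower hc hRa hν h0 b).nearLocus N (c b).pt (Seg.relIdxL hgen b 0 1)) = (upTower hc hRa hν h0 b).nearLocus N (c b).pt (Seg.relIdxL hgen b 0 1) :=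
    Set.image_preimage_eq_of_subset hrange
  have hxb : IsClosed ({(((upTower hc hRa hν h0 b).X 0).fromSpecStalk ((c b).pt : (upTower hc hRa hν h0 b).X 0)).base (basePt hc hRa hν h0 b)} :
      Set ((upTower hc hRa hν h0 b).X 0)) := by
    rw [show (((upTower hc hRa hν h0 b).X 0).fromSpecStalk ((c b).pt : (upTower hc hRa hν h0 b).X 0)).base (basePt hc hRa hν h0 b) = (c b).pt
      from Scheme.fromSpecStalk_closedPoint]
    exact Reaches.isClosed_pt hX.isClosed (reaches_chain hreach hc b)
  have hNeq : (unitTowerL hc hRa hν h0 hgen b 0 hempL).nearLocus N (basePt hc hRa hν h0 b) 1 =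
      (locTower hc hRa hν h0 b).nearLocus N (basePt hc hRa hν h0 b) (Seg.relIdxL hgen b 0 1) :=
    (locTower hc hRa hν h0 b).nearLocus_compress_zero (htriv_of_hEmpL hc hRa hν h0 hgen hempL) N (basePt hc hRa hν h0 b) 1
  have hclUp : ∀ s ∈ (unitTowerL hc hRa hν h0 hgen b 0 hempL).nearLocus N (basePt hc hRa hν h0 b) 1,
      IsClosed ({s} : Set ((unitTowerL hc hRa hν h0 hgen b 0 hempL).X 1)) →
      IsClosed ({(locι hc hRa hν h0 b (Seg.relIdxL hgen b 0 1)).base s} : Set (c (b + Seg.relIdxL hgen b 0 1)).W) := by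
    intro s hs hscl
    rw [hNeq] at hs
    exact BlowupTowerNear.isClosed_singleton_bcι_of_phi_eq (upTower hc hRa hν h0 b)
      (((upTower hc hRa hν h0 b).X 0).fromSpecStalk ((c b).pt : (upTower hc hRa hν h0 b).X 0)) (basePt hc hRa hν h0 b) _ hxb hs.1 hscl
  -- Noetherian / Jacobson chain stage
  have hcyc : Helpers.CycleInv k N ν (c (b + Seg.relIdxL hgen b 0 1)) := cycleInv_at hc hRa hν h0 _
  obtain ⟨f, hft, hqc⟩ := hcyc.1
  haveI := hft; haveI := hqc
  haveI : IsNoetherian (c (b + Seg.relIdxL hgen b 0 1)).W := Scheme.isNoetherian_of_finiteType_over_field f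
  haveI : NoetherianSpace ((upTower hc hRa hν h0 b).X (Seg.relIdxL hgen b 0 1)) :=
    IsNoetherian.noetherianSpace (X := (c (b + Seg.relIdxL hgen b 0 1)).W)
  haveI : JacobsonSpace ((upTower hc hRa hν h0 b).X (Seg.relIdxL hgen b 0 1)) := LocallyOfFiniteType.jacobsonSpace (X := (c (b + Seg.relIdxL hgen b 0 1)).W) f
  by_cases hηN : hKirr.genericPoint ∈ (unitTowerL hc hRa hν h0 hgen b 0 hempL).nearLocus N (basePt hc hRa hν h0 b) 1
  · -- dominant: `N_1 = ℙ(Dir)`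
    have hηK := hKirr.isGenericPoint_genericPoint hKcl
    have hNK : (unitTowerL hc hRa hν h0 hgen b 0 hempL).nearLocus N (basePt hc hRa hν h0 b) 1 =
        (unitTowerL hc hRa hν h0 hgen b 0 hempL).projDir (basePt hc hRa hν h0 b) := by
      refine Set.Subset.antisymm hsub ?_
      rw [← hηK.def]
      exact closure_minimal (Set.singleton_subset_iff.mpr hηN) hNTcl
    -- irreducible / curve data / a non-closed point, transferred up
    have hirrUp : IsIrreducible ((upTower hc hRa hν h0 b).nearLocus N (c b).pt (Seg.relIdxL hgen b 0 1)) := by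
      have h1 : IsIrreducible ((locι hc hRa hν h0 b (Seg.relIdxL hgen b 0 1)).base ⁻¹' (upTower hc hRa hν h0 b).nearLocus N (c b).pt (Seg.relIdxL hgen b 0 1)) := by
        rw [← hNeq', hNK]; exact hKirr
      have := h1.image _ (locι hc hRa hν h0 b _).continuous.continuousOn
      rwa [hsurj] at this
    have hηncl : ¬ IsClosed ({hKirr.genericPoint} : Set ((unitTowerL hc hRa hν h0 hgen b 0 hempL).X 1)) := hKgen _ hηK
    have hne : ∃ z ∈ (upTower hc hRa hν h0 b).nearLocus N (c b).pt (Seg.relIdxL hgen b 0 1), ¬ IsClosed ({z} : Set (c (b + Seg.relIdxL hgen b 0 1)).W) := by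
      have h := BlowupTowerNear.exists_not_isClosed_singleton_nearLocus_of_baseChange (upTower hc hRa hν h0 b)
        (((upTower hc hRa hν h0 b).X 0).fromSpecStalk ((c b).pt : (upTower hc hRa hν h0 b).X 0)) N (basePt hc hRa hν h0 b) (Seg.relIdxL hgen b 0 1)
        ⟨hKirr.genericPoint, hNeq ▸ hηN, hηncl⟩
      rw [show (((upTower hc hRa hν h0 b).X 0).fromSpecStalk ((c b).pt : (upTower hc hRa hν h0 b).X 0)).base (basePt hc hRa hν h0 b) = (c b).pt
        from Scheme.fromSpecStalk_closedPoint] at h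
      exact h
    have hinfUp : ((upTower hc hRa hν h0 b).nearLocus N (c b).pt (Seg.relIdxL hgen b 0 1)).Infinite := by
      obtain ⟨z, hz, hzcl⟩ := hne
      exact infinite_of_isIrreducible_of_not_isClosed hNcl hz hzcl
    refine ⟨Or.inl ⟨hinfUp, hirrUp, fun y hy hng => ?_⟩, fun _ h' => ?_⟩
    · obtain ⟨s, hs, rfl⟩ := hsurj.symm.subset hy
      have hs' : s ∈ (unitTowerL hc hRa hν h0 hgen b 0 hempL).nearLocus N (basePt hc hRa hν h0 b) 1 := by rw [hNeq']; exact hs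
      refine hclUp s hs' (hKpts s (hNK ▸ hs') fun hgs => hng ?_)
      have hgs' : IsGenericPoint s ((locι hc hRa hν h0 b (Seg.relIdxL hgen b 0 1)).base ⁻¹'
          (upTower hc hRa hν h0 b).nearLocus N (c b).pt (Seg.relIdxL hgen b 0 1)) := by rw [← hNeq', hNK]; exact hgs
      exact (isGenericPoint_iff_of_isEmbedding hemb hNcl hsurj hs).mp hgs'
    · -- regularity: `V_red(N^T_1) = V_red(ℙ(Dir))` is regular by P-a, then transfer up
      have hS' : IsClosed ((locTower hc hRa hν h0 b).nearLocus N (basePt hc hRa hν h0 b) (Seg.relIdxL hgen b 0 1)) := by rw [← hNeq]; exact hNTcl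
      have hregT : Scheme.IsRegular (Scheme.IdealSheafData.vanishingIdeal
          (⟨(locTower hc hRa hν h0 b).nearLocus N (basePt hc hRa hν h0 b) (Seg.relIdxL hgen b 0 1), hS'⟩ :
            Closeds ((locTower hc hRa hν h0 b).X (Seg.relIdxL hgen b 0 1)))).subscheme := by
        have e : (⟨(unitTowerL hc hRa hν h0 hgen b 0 hempL).projDir (basePt hc hRa hν h0 b), hKcl⟩ :
            Closeds ((locTower hc hRa hν h0 b).X (Seg.relIdxL hgen b 0 1))) =
            ⟨(locTower hc hRa hν h0 b).nearLocus N (basePt hc hRa hν h0 b) (Seg.relIdxL hgen b 0 1), hS'⟩ := Closeds.ext (hNK.symm.trans hNeq)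
        rw [← e]
        intro y
        have hy : (Scheme.IdealSheafData.vanishingIdeal (⟨(unitTowerL hc hRa hν h0 hgen b 0 hempL).projDir (basePt hc hRa hν h0 b), hKcl⟩ :
            Closeds ((locTower hc hRa hν h0 b).X (Seg.relIdxL hgen b 0 1)))).subschemeι.base y ∈ (unitTowerL hc hRa hν h0 hgen b 0 hempL).projDir (basePt hc hRa hν h0 b) := by
          have := Set.mem_range_self (f := (Scheme.IdealSheafData.vanishingIdeal (⟨(unitTowerL hc hRa hν h0 hgen b 0 hempL).projDir (basePt hc hRa hν h0 b), hKcl⟩ :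
            Closeds ((locTower hc hRa hν h0 b).X (Seg.relIdxL hgen b 0 1)))).subschemeι.base) y
          rw [Scheme.IdealSheafData.range_subschemeι, Scheme.IdealSheafData.coe_support_vanishingIdeal] at this
          exact this
        exact (isRegularLocalRing_stalk_subscheme_iff _ y).mpr (hKreg hKcl _ hy).1
      exact BlowupTowerNear.isRegular_nearLocus_of_localize (upTower hc hRa hν h0 b) N (c b).pt _ hS' h' hregT
  · -- not dominant: all points of `N_1` are closed, hence `N_1` is finite
    have hclT : ∀ s ∈ (unitTowerL hc hRa hν h0 hgen b 0 hempL).nearLocus N (basePt hc hRa hν h0 b) 1,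
        IsClosed ({s} : Set ((unitTowerL hc hRa hν h0 hgen b 0 hempL).X 1)) := fun s hs =>
      hKpts s (hsub hs) fun hgen => hηN ((hgen.eq (hKirr.isGenericPoint_genericPoint hKcl)) ▸ hs)
    have hclUp' : ∀ y ∈ (upTower hc hRa hν h0 b).nearLocus N (c b).pt (Seg.relIdxL hgen b 0 1), IsClosed ({y} : Set (c (b + Seg.relIdxL hgen b 0 1)).W) := by
      intro y hy
      obtain ⟨s, hs, rfl⟩ := hsurj.symm.subset hy
      have hs' : s ∈ (unitTowerL hc hRa hν h0 hgen b 0 hempL).nearLocus N (basePt hc hRa hν h0 b) 1 := by rw [hNeq']; exact hs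
      exact hclUp s hs' (hclT s hs')
    have hfin := finite_of_forall_isClosed_singleton hNcl hclUp'
    exact ⟨Or.inr ⟨hfin, hclUp'⟩, fun hinf => absurd hfin hinf⟩

end BirthZeroF

/-! ## §3. Clause (ii)′ of Def. 6.38 on the unit tower, keyed on `F` -/

section UnitF

variable {R : ∀ S : Scheme.{0}, CentreSeq S → Prop} {N : ℕ} {ν : ℕ → ℕ} {k : Type} [Field k]
  {c : ℕ → MarkedStage.{0}} (hc : ∀ n, CanonicalNearStep R N ν (c n) (c (n + 1))) (hRf : OracleFunctional R) (hRa : OracleAdmissible R)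
  (hν : ν ≠ iterPSum N Phi) (h0 : Helpers.CycleInv k N ν (c 0)) (hgen : ∀ n, ∃ m, n ≤ m ∧ (c m).IsBlownUp R N ν)
  (hBG : ∀ n, ∃ m, n ≤ m ∧ (c m).IsBlownUp R N ν ∧ Iso N (c m))
  {p : ℕ} {X : Scheme.{0}} [IsLocallyNoetherian X] {x : X} (hX : IsMaximalOrigin p N ν X x)
  (hreach : Reaches R N ν (MarkedStage.init X x) (c 0))
  (F : ∀ (X : Scheme.{0}) [IsLocallyNoetherian X], X → Prop)
  (h314pt : ∀ (X X' : Scheme.{0}) [IsLocallyNoetherian X] (π : X' ⟶ X) (x : X) (hx : IsClosed ({x} : Set X)) (N : ℕ)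
    (x' : X'), Scheme.IsExcellent X → IdealSheafData.IsPermissible (Scheme.IdealSheafData.vanishingIdeal ⟨{x}, hx⟩) →
      IsBlowup π (Scheme.IdealSheafData.vanishingIdeal ⟨{x}, hx⟩) → topologicalKrullDim ↥X ≤ (N : WithBot ℕ∞) → π.base x' = x → F X x →
        Scheme.hsFun X' N x' = Scheme.hsFun X N x → IsOnProjDirectrix π x')

include hRf hX hreach h314pt in
/-- **CLAUSE (ii)′ OF Def. 6.38 FOR THE REPAIRED UNIT TOWER, keyed on a point hypothesis `F`: `C_1 = ℙ(Dir_{𝔪_{x_b}})`** for a unit of length `≥ 2`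
at a blown-up isolated base, with `F` along the near loci of `locTower b`, modulo the point-locus form of Thm. 3.14 keyed on `F` (`h314pt`), given
(Dich)/(RegN) inside the unit. `F := CharHypothesis` recovers `Seg.unitTowerU_C_one_eq_projDir`. [cite: CossartJannsenSaito2020, Def. 6.38 (ii), Thm. 3.14, Lemma 6.33] -/
theorem unitTowerU_C_one_eq_projDirF (b : ℕ) (hb : (c b).IsBlownUp R N ν) (hiso : Iso N (c b))
    (hF : ∀ n, ∀ y ∈ (locTower hc hRa hν h0 b).nearLocus N (basePt hc hRa hν h0 b) n,
      @F ((locTower hc hRa hν h0 b).X n) ((locTower hc hRa hν h0 b).ln n) y)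
    (h22 : ∀ n, Iso N (c n) → dirDim (c n) = 2 ∧ (c n).geomDirDim = 2)
    (hDich : ∀ n, 0 < n → n < Seg.relIdxU hgen hBG b (Seg.relLen hgen hBG b) →
      (((upTower hc hRa hν h0 b).nearLocus N (c b).pt n).Infinite ∧ IsIrreducible ((upTower hc hRa hν h0 b).nearLocus N (c b).pt n)) ∨
      (((upTower hc hRa hν h0 b).nearLocus N (c b).pt n).Finite ∧
        ∀ y ∈ (upTower hc hRa hν h0 b).nearLocus N (c b).pt n, IsClosed ({y} : Set (c (b + n)).W)))
    (hReg : ∀ n, 0 < n → n < Seg.relIdxU hgen hBG b (Seg.relLen hgen hBG b) → ((upTower hc hRa hν h0 b).nearLocus N (c b).pt n).Infinite →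
      ∀ h : IsClosed ((upTower hc hRa hν h0 b).nearLocus N (c b).pt n),
        Scheme.IsRegular (Scheme.IdealSheafData.vanishingIdeal ⟨(upTower hc hRa hν h0 b).nearLocus N (c b).pt n, h⟩).subscheme)
    (hemp : HEmpU hc hRa hν h0 hgen hBG b) (h2 : 2 ≤ unitLen hgen hBG b) :
    (unitTowerU hc hRa hν h0 hgen hBG b hemp).C 1 = (unitTowerU hc hRa hν h0 hgen hBG b hemp).projDir (basePt hc hRa hν h0 b) := by
  haveI : IsLocallyNoetherian ((upTower hc hRa hν h0 b).X 0) := (upTower hc hRa hν h0 b).ln 0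
  haveI := flat_fromSpecStalk ((upTower hc hRa hν h0 b).X 0) ((c b).pt : (upTower hc hRa hν h0 b).X 0)
  obtain ⟨k', _, _, hg⟩ := hX.exists_stateGood_of_reaches hRa hν (reaches_chain hreach hc b)
  have hU := stratumIsolated_of_iso hg hiso
  -- (iii) at rank 1
  have hC1 : (unitTowerU hc hRa hν h0 hgen hBG b hemp).C 1 = (unitTowerU hc hRa hν h0 hgen hBG b hemp).nearLocus N (basePt hc hRa hν h0 b) 1 :=
    unitTowerU_C_eq_nearLocus hc hRf hRa hν h0 hgen hBG hX hreach b hb hiso hDich hReg hemp (Nat.lt_of_succ_le h2)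
  -- `N_1 ⊆ ℙ(Dir)` (Thm. 3.14, point locus) and the curve data of `ℙ(Dir)`
  have hC0 : (unitTowerU hc hRa hν h0 hgen hBG b hemp).C 0 = {basePt hc hRa hν h0 b} :=
    unitTowerU_C_zero hc hRa hν h0 hgen hBG hRf hX b hemp (reaches_chain hreach hc b) hb hU
  have hsub : (unitTowerU hc hRa hν h0 hgen hBG b hemp).nearLocus N (basePt hc hRa hν h0 b) 1 ⊆
      (unitTowerU hc hRa hν h0 hgen hBG b hemp).projDir (basePt hc hRa hν h0 b) :=
    BlowupTowerNearW.nearLocus_one_subset_projDir (T := unitTowerU hc hRa hν h0 hgen hBG b hemp) F h314pt (keySetting_unitTowerU hc hRa hν h0 hgen hBG b hemp)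
      (isPermissible_centreIdeal_unitTowerU hc hRa hν h0 hgen hBG b hemp) (isClosed_basePtU hc hRa hν h0 hgen hBG b hemp) hC0
      (fun i y hy => hF (Seg.relIdxU hgen hBG b i) y
        (((locTower hc hRa hν h0 b).nearLocus_compress_zero (htriv_of_hEmpU hc hRa hν h0 hgen hBG hemp) N (basePt hc hRa hν h0 b) i) ▸ hy))
  have he : (unitTowerU hc hRa hν h0 hgen hBG b hemp).dirDimAt 0 (basePt hc hRa hν h0 b) = 2 := (dirDimAt_unitTowerU_zero hc hRa hν h0 hgen hBG b hemp).trans (h22 b hiso).1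
  obtain ⟨hKcl, hKirr, -, hKpts⟩ := BlowupTowerNear.curveData_projDir (T := unitTowerU hc hRa hν h0 hgen hBG b hemp) ProjDir_projLine_holds
    (isClosed_basePtU hc hRa hν h0 hgen hBG b hemp) hC0 he
  -- `N_1` of the unit tower is the localised near locus of the chain at the first kept index `g_1`
  have h1lt : Seg.relIdxU hgen hBG b 1 < Seg.relIdxU hgen hBG b (Seg.relLen hgen hBG b) :=
    BlowupTower.cidx_strictMono 0 _ (Nat.lt_of_succ_le h2)
  have h1pos : 0 < Seg.relIdxU hgen hBG b 1 := BlowupTower.cidx_strictMono 0 _ Nat.one_pos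
  have hN : (unitTowerU hc hRa hν h0 hgen hBG b hemp).nearLocus N (basePt hc hRa hν h0 b) 1 =
      (locι hc hRa hν h0 b (Seg.relIdxU hgen hBG b 1)).base ⁻¹' (upTower hc hRa hν h0 b).nearLocus N (c b).pt (Seg.relIdxU hgen hBG b 1) := by
    have h1 := (locTower hc hRa hν h0 b).nearLocus_compress_zero (htriv_of_hEmpU hc hRa hν h0 hgen hBG hemp) N (basePt hc hRa hν h0 b) 1
    have h2' := (upTower hc hRa hν h0 b).nearLocus_baseChange
      (((upTower hc hRa hν h0 b).X 0).fromSpecStalk ((c b).pt : (upTower hc hRa hν h0 b).X 0)) N (basePt hc hRa hν h0 b) (Seg.relIdxU hgen hBG b 1)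
    rw [show (((upTower hc hRa hν h0 b).X 0).fromSpecStalk ((c b).pt : (upTower hc hRa hν h0 b).X 0)).base (basePt hc hRa hν h0 b) = (c b).pt
      from Scheme.fromSpecStalk_closedPoint] at h2'
    exact h1.trans h2'
  -- the chain's near locus at `g_1` is infinite irreducible (the stage is not `Iso`: rank `1 < unitLen`)
  have hnotG : ¬ Iso N (c (b + Seg.relIdxU hgen hBG b 1)) := by
    rw [Seg.relIdxU_eq_of_le hgen hBG b (Nat.le_of_succ_le h2)]
    exact Seg.not_G_add_relIdx_of_lt_relLen hgen hBG b le_rfl (Nat.lt_of_succ_le h2)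
  obtain ⟨hinf, hirr⟩ := infinite_irreducible_nearLocus_of_not_iso hc hRa hν h0 hX hreach b hU _ hnotG (hDich _ h1pos h1lt)
  -- transfer down the localisation embedding
  have hrange : (upTower hc hRa hν h0 b).nearLocus N (c b).pt (Seg.relIdxU hgen hBG b 1) ⊆
      Set.range (locι hc hRa hν h0 b (Seg.relIdxU hgen hBG b 1)).base := by
    have h := BlowupTowerNear.nearLocus_subset_range_bcι (upTower hc hRa hν h0 b)
      (((upTower hc hRa hν h0 b).X 0).fromSpecStalk ((c b).pt : (upTower hc hRa hν h0 b).X 0)) N (basePt hc hRa hν h0 b) (Seg.relIdxU hgen hBG b 1)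
    rw [show (((upTower hc hRa hν h0 b).X 0).fromSpecStalk ((c b).pt : (upTower hc hRa hν h0 b).X 0)).base (basePt hc hRa hν h0 b) = (c b).pt
      from Scheme.fromSpecStalk_closedPoint] at h
    exact h
  have hemb : Topology.IsEmbedding (locι hc hRa hν h0 b (Seg.relIdxU hgen hBG b 1)).base :=
    @Scheme.Hom.isEmbedding _ _ (locι hc hRa hν h0 b (Seg.relIdxU hgen hBG b 1))
      ((upTower hc hRa hν h0 b).isPreimmersion_bcι (((upTower hc hRa hν h0 b).X 0).fromSpecStalk ((c b).pt : (upTower hc hRa hν h0 b).X 0)) _)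
  have hZirr : IsIrreducible ((unitTowerU hc hRa hν h0 hgen hBG b hemp).nearLocus N (basePt hc hRa hν h0 b) 1) := by
    rw [hN]
    exact isIrreducible_preimage_of_isEmbedding hemb hirr hrange
  have hZinf : ((unitTowerU hc hRa hν h0 hgen hBG b hemp).nearLocus N (basePt hc hRa hν h0 b) 1).Infinite := by
    rw [hN]; exact hinf.preimage hrange
  have hZcl : IsClosed ((unitTowerU hc hRa hν h0 hgen hBG b hemp).nearLocus N (basePt hc hRa hν h0 b) 1) := by
    rw [hN]; exact (isClosed_nearLocus hc hRa hν h0 hX hreach b _).preimage (locι hc hRa hν h0 b _).continuous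
  rw [hC1]
  exact eq_of_isIrreducible_infinite_subset_curveLike hKirr hKcl hKpts hZirr hZcl hZinf hsub

end UnitF

end Summit.ResolutionOfSingularities.ResolutionOfSingularities.Theorems.SigmaMaxModificationsCorridor3.Moving.Seg

end
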